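import Mathlib
import HarnessLib
import Literature.Analysis.FluidPDE.VectorCalculus

/-!
# Compactly supported steady flows with straight streamlines, or with a missing direction, vanish

Two elementary rigidity lemmas for compactly supported fields, used by the axisymmetric analysis of
the kill crux `AdiabaticEddy.NoFrozenEddyCollapse` (stmt-NavierStokesRegularity-1431) of route
AdiabaticEddy (off-axis centre paths, see `Cruxes/FrozenEddyCollapse/Lines/SketchIdeator1-dead.md`
§4.4) but stated in general:

* `eq_zero_of_convect_self_eq_zero` — **pressureless steady flows**: a compactly supported `C¹` field
  `U` on a finite-dimensional space with `(U·∇)U ≡ 0` vanishes.  Along the straight line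
  `t ↦ x₀ + t U(x₀)` the defect `w(t) = U(x₀ + tU(x₀)) − U(x₀)` solves the linear ODE
  `w' = −DU(x₀ + tU(x₀)) w`, `w(0) = 0`, so `w ≡ 0` (Grönwall), i.e. the particle keeps the velocity
  `U(x₀) ≠ 0` forever and leaves the support — contradiction.
* `eq_zero_of_steadyEuler_of_inner_eq_zero` — **steady Euler flows with a missing direction**: if a
  compactly supported `C¹` field `U` solves `(U·∇)U + ∇P = 0` with a differentiable pressure and
  `⟪U, e⟫ ≡ 0` for some `e ≠ 0`, then `U ≡ 0`: the `e`-component of the equation gives `∂ₑP ≡ 0`, so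
  `∇P` is invariant under translation by `e` and vanishes far out along every `e`-line (where `U = 0`),
  hence `∇P ≡ 0` and the first lemma applies.  (No incompressibility is used.)
-/

noncomputable section

-- the summit-side namespace repeats a component by design (D-0017)
set_option linter.dupNamespace false

namespace Summit.NavierStokesRegularity.NavierStokesRegularity.Theorems

open Set Metric
open scoped InnerProductSpace
open Literature.Analysis.FluidPDE

/-- **A compactly supported `C¹` field with `(U·∇)U ≡ 0` vanishes** (straight streamlines run at
constant velocity cannot stay in a compact set).  Here `(U·∇)U (x) = DU(x)[U x]`
(`Literature.Analysis.FluidPDE.convect U U`). [folklore] -/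
theorem eq_zero_of_convect_self_eq_zero {E : Type*} [NormedAddCommGroup E] [NormedSpace ℝ E]
    [FiniteDimensional ℝ E] {U : E → E} (hU : ContDiff ℝ 1 U) (hUc : HasCompactSupport U)
    (h : ∀ x, fderiv ℝ U x (U x) = 0) : U = 0 := by
  -- a uniform bound on `DU`
  have hcontD : Continuous (fderiv ℝ U) := hU.continuous_fderiv one_ne_zero
  have hDc : HasCompactSupport (fderiv ℝ U) := hUc.fderiv (𝕜 := ℝ)
  obtain ⟨K, hK⟩ : ∃ K : ℝ, ∀ x, ‖fderiv ℝ U x‖ ≤ K := by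
    obtain ⟨K, hK⟩ := (hDc.isCompact_range hcontD).isBounded.exists_norm_le
    exact ⟨K, fun x => hK _ (mem_range_self x)⟩
  -- the support lies in a ball
  obtain ⟨R, hR⟩ : ∃ R : ℝ, tsupport U ⊆ closedBall (0 : E) R :=
    hUc.isCompact.isBounded.subset_closedBall 0
  have hdiff : Differentiable ℝ U := hU.differentiable one_ne_zero
  funext x₀
  by_contra hx₀
  simp only [Pi.zero_apply] at hx₀
  set v : E := U x₀ with hv
  have hvpos : 0 < ‖v‖ := norm_pos_iff.2 hx₀
  -- the defect along the straight line
  set w : ℝ → E := fun t => U (x₀ + t • v) - v with hw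
  have hline : ∀ t, HasDerivAt (fun t : ℝ => x₀ + t • v) v t := fun t => by
    simpa using ((hasDerivAt_id t).smul_const v).const_add x₀
  have hderiv : ∀ t, HasDerivAt w (fderiv ℝ U (x₀ + t • v) v) t := fun t => by
    have h1 : HasDerivAt (fun t : ℝ => U (x₀ + t • v)) (fderiv ℝ U (x₀ + t • v) v) t :=
      ((hdiff (x₀ + t • v)).hasFDerivAt.comp_hasDerivAt t (hline t))
    simpa [hw] using h1.sub_const v
  -- the linear ODE `w' = -DU w`
  have hkey : ∀ t, fderiv ℝ U (x₀ + t • v) v = -(fderiv ℝ U (x₀ + t • v) (w t)) := fun t => by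
    simp only [hw, map_sub, h (x₀ + t • v), zero_sub, neg_neg]
  have hzero : ∀ b : ℝ, ∀ t ∈ Icc 0 b, w t = 0 := fun b =>
    eq_zero_of_abs_deriv_le_mul_abs_self_of_eq_zero_right (K := K)
      (fun t _ => (hderiv t).continuousAt.continuousWithinAt)
      (fun t _ => (hderiv t).hasDerivWithinAt)
      (by simp [hw, hv])
      (fun t _ => by
        rw [hkey t, norm_neg]
        exact (ContinuousLinearMap.le_opNorm _ _).trans
          (mul_le_mul_of_nonneg_right (hK _) (norm_nonneg _)))
  -- far out along the line the field vanishes, yet it equals `v ≠ 0`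
  set t₁ : ℝ := (|R| + ‖x₀‖ + 1) / ‖v‖ with ht₁
  have ht₁pos : 0 ≤ t₁ := by rw [ht₁]; positivity
  have hout : x₀ + t₁ • v ∉ tsupport U := by
    intro hmem
    have h1 : ‖x₀ + t₁ • v‖ ≤ R := mem_closedBall_zero_iff.1 (hR hmem)
    have h2 : t₁ * ‖v‖ - ‖x₀‖ ≤ ‖x₀ + t₁ • v‖ := by
      have := norm_sub_norm_le (t₁ • v) (-x₀)
      rw [norm_smul, Real.norm_eq_abs, abs_of_nonneg ht₁pos, norm_neg, sub_neg_eq_add,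
        add_comm] at this
      linarith
    have h3 : t₁ * ‖v‖ = |R| + ‖x₀‖ + 1 := by
      rw [ht₁, div_mul_cancel₀ _ hvpos.ne']
    linarith [le_abs_self R]
  have hUout : U (x₀ + t₁ • v) = 0 := image_eq_zero_of_notMem_tsupport hout
  have hw1 : w t₁ = 0 := hzero t₁ t₁ ⟨ht₁pos, le_rfl⟩
  have : v = 0 := by
    have := hw1
    simp only [hw, hUout, zero_sub, neg_eq_zero] at this
    exact this
  exact hx₀ (by simpa [hv] using this)

/-- **A compactly supported steady Euler flow missing a direction vanishes.** Let `U` be a compactly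
supported `C¹` field on a finite-dimensional inner product space and `P` a differentiable pressure
with `(U·∇)U + ∇P = 0` pointwise (`Literature.Analysis.FluidPDE.convect`, Mathlib `gradient`).  If
`⟪U x, e⟫ = 0` for all `x` and some `e ≠ 0`, then `U = 0`: the `e`-component of the equation is
`∂ₑP = 0`, so `∇P (x + s • e) = ∇P x`; far along the `e`-line `U = 0`, so `∇P ≡ 0`, `(U·∇)U ≡ 0`, and
`eq_zero_of_convect_self_eq_zero` applies.  Incompressibility is not needed. [folklore] -/
theorem eq_zero_of_steadyEuler_of_inner_eq_zero {E : Type*} [NormedAddCommGroup E]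
    [InnerProductSpace ℝ E] [FiniteDimensional ℝ E] {U : E → E} {P : E → ℝ}
    (hU : ContDiff ℝ 1 U) (hUc : HasCompactSupport U) (hP : Differentiable ℝ P)
    (hE : ∀ x, convect U U x + gradient P x = 0) {e : E} (he : e ≠ 0)
    (hUe : ∀ x, ⟪U x, e⟫_ℝ = 0) : U = 0 := by
  have hdiff : Differentiable ℝ U := hU.differentiable one_ne_zero
  -- `⟪DU(x) w, e⟫ = 0`: differentiate the identity `⟪U ·, e⟫ ≡ 0`
  have hDe : ∀ x w, ⟪fderiv ℝ U x w, e⟫_ℝ = 0 := by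
    intro x w
    have hcomp : ((innerSL ℝ e : E →L[ℝ] ℝ) ∘ U) = fun _ => (0 : ℝ) := by
      funext y
      have h := hUe y
      rw [real_inner_comm] at h
      simpa using h
    have h1 : HasFDerivAt ((innerSL ℝ e : E →L[ℝ] ℝ) ∘ U) ((innerSL ℝ e).comp (fderiv ℝ U x)) x :=
      (innerSL ℝ e).hasFDerivAt.comp x (hdiff x).hasFDerivAt
    have h2 : HasFDerivAt ((innerSL ℝ e : E →L[ℝ] ℝ) ∘ U) (0 : E →L[ℝ] ℝ) x := by
      rw [hcomp]; exact hasFDerivAt_const 0 x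
    have h3 := h1.unique h2
    have := congrArg (fun L : E →L[ℝ] ℝ => L w) h3
    simpa [real_inner_comm] using this
  -- `∂ₑ P ≡ 0`
  have hPe : ∀ x, fderiv ℝ P x e = 0 := by
    intro x
    have h1 : ⟪convect U U x + gradient P x, e⟫_ℝ = 0 := by rw [hE x, inner_zero_left]
    rw [inner_add_left, convect, hDe, zero_add, gradient, InnerProductSpace.toDual_symm_apply] at h1
    exact h1
  -- `P` is invariant under translation by `e`
  have hPconst : ∀ x (s : ℝ), P (x + s • e) = P x := by
    intro x s
    have hl : ∀ r : ℝ, HasDerivAt (fun r : ℝ => x + r • e) e r := fun r => by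
      simpa using ((hasDerivAt_id r).smul_const e).const_add x
    have hg := fun r : ℝ => (hP (x + r • e)).hasFDerivAt.comp_hasDerivAt r (hl r)
    have hconst := is_const_of_deriv_eq_zero (fun r => (hg r).differentiableAt)
      (fun r => by rw [(hg r).deriv, hPe]) s 0
    simpa using hconst
  -- hence so is `∇P`
  have hgrad : ∀ x (s : ℝ), gradient P (x + s • e) = gradient P x := by
    intro x s
    have hfun : (fun y => P (y + s • e)) = P := funext fun y => hPconst y s
    have h1 : fderiv ℝ (fun y => P (y + s • e)) x = fderiv ℝ P (x + s • e) :=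
      fderiv_comp_add_right (s • e)
    rw [hfun] at h1
    simp only [gradient, h1]
  -- far out along the `e`-line the field, hence `∇P`, vanishes
  obtain ⟨R, hR⟩ : ∃ R : ℝ, tsupport U ⊆ closedBall (0 : E) R :=
    hUc.isCompact.isBounded.subset_closedBall 0
  have hepos : 0 < ‖e‖ := norm_pos_iff.2 he
  have hgrad0 : ∀ x, gradient P x = 0 := by
    intro x
    set s : ℝ := (|R| + ‖x‖ + 1) / ‖e‖ with hs
    have hspos : 0 ≤ s := by rw [hs]; positivity
    have hout : x + s • e ∉ tsupport U := by
      intro hmem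
      have h1 : ‖x + s • e‖ ≤ R := mem_closedBall_zero_iff.1 (hR hmem)
      have h2 : s * ‖e‖ - ‖x‖ ≤ ‖x + s • e‖ := by
        have := norm_sub_norm_le (s • e) (-x)
        rw [norm_smul, Real.norm_eq_abs, abs_of_nonneg hspos, norm_neg, sub_neg_eq_add,
          add_comm] at this
        linarith
      have h3 : s * ‖e‖ = |R| + ‖x‖ + 1 := by rw [hs, div_mul_cancel₀ _ hepos.ne']
      linarith [le_abs_self R]
    -- `U` vanishes on the open complement of its topological support, so `DU = 0` there too
    have hUz : U (x + s • e) = 0 := image_eq_zero_of_notMem_tsupport hout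
    have hconv : convect U U (x + s • e) = 0 := by simp [convect, hUz]
    have := hE (x + s • e)
    rw [hconv, zero_add, hgrad x s] at this
    exact this
  -- so the flow is pressureless
  have hconv0 : ∀ x, fderiv ℝ U x (U x) = 0 := fun x => by
    have := hE x
    rwa [hgrad0 x, add_zero] at this
  exact eq_zero_of_convect_self_eq_zero hU hUc hconv0

end Summit.NavierStokesRegularity.NavierStokesRegularity.Theorems

end
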